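import Mathlib
import Literature.NumberTheory.Irrationality.BrownZudilin2022.CubicalForm
import Summits.KontsevichZagierPeriods.Zeta5Search.CubicalSubstitution
import HarnessLib

/-!
# ζ(5) search — the fibration change of variables `Θ` over `P = y₁y₂` for `J(p;q)` (cell `pub-zeta5`, seat ct-1 g12)

HONEST FRAMING: systematic search; no irrationality claim unless kernel-certified. Nothing in this file is an
irrationality result, a worthiness exponent or a denominator statement; it is a change of variables in Brown–Zudilin's
five-fold integral `J(p;q)` (10) [BrownZudilin2022, Sect. 3], the geometric input for the symmetry `p₁₂` beyond the
chamber of (16) (`JintegralEulerP12.lean`).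

* `Θ : (σ, P, y₃, y₄, y₅) ↦ (Y, P/Y, y₃, y₄, y₅)`, `Y = P + (1−P)σ` — a bijection of the open cube `(0,1)⁵` (inverse
  `(y₁,…,y₅) ↦ (y₁(1−y₂)/(1−y₁y₂), y₁y₂, y₃, y₄, y₅)`; `theta_image`, `theta_injOn`), differentiable with Jacobian
  determinant `(1−P)/Y` (`hasFDerivAt_theta`: the `5×5` matrix is block `2 + 3`, `det_pattern`); in the new coordinates
  the product `y₁y₂ = P` is a coordinate, so the two 'links' `1 − y₃(1 − y₁y₂)`, `1 − y₃(1 − y₄y₅)` of (10) do not see the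
  fibre variable `σ`;
* `Jintegral_theta` — `J(p;q) = ∫_{(0,1)⁵} (1−P)/Y · integrandJ p q (Θ z) dz` for EVERY `(p;q)` (Bochner change of variables
  `MeasureTheory.integral_image_eq_integral_abs_det_fderiv_smul`; no integrability hypothesis);
* `theta_integrand_coord` — the transformed integrand in coordinates: with `q₁ = n₁`, `q₂ = n₂`, `p₂ + q₂ − p₁ = m`,
  `(1−P)/Y · integrandJ p q (Y, P/Y, u, v, w) = R(P,u,v,w) · P^{p₂}(1−P)^{n₁+n₂+1}/(1−u(1−P))^{p₀+1} · σ^{n₂}(1−σ)^{n₁}/Y^{m+1}`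
  — the fibre integrand is an Euler `₂F₁` kernel in `σ` with `α = P`, `β = 1 − P`.

Theorems only (no new definitions); the pattern of `CubicalSubstitution.lean` (ct-1 g10).
-/

noncomputable section

namespace Summit.KontsevichZagierPeriods.Zeta5Search.JintegralEulerTheta

open MeasureTheory Set Filter
open ContinuousLinearMap (proj)
open scoped ENNReal Nat
open Literature.NumberTheory.Irrationality.BrownZudilin2022
open Summit.KontsevichZagierPeriods.Zeta5Search.CubicalSubstitution (measurableSet_openCube)

/-! ### The fibration change of variables `Θ : (σ, P, y₃, y₄, y₅) ↦ (P+(1−P)σ, P/(P+(1−P)σ), y₃, y₄, y₅)` -/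

/-- For `0 < σ, P < 1`: `Y = P + (1−P)σ` satisfies `P < Y < 1` (hence `0 < Y`). -/
theorem Y_bounds {σ P : ℝ} (hσ : 0 < σ ∧ σ < 1) (hP : 0 < P ∧ P < 1) :
    P < P + (1 - P) * σ ∧ P + (1 - P) * σ < 1 := by
  constructor
  · nlinarith [mul_pos (sub_pos.mpr hP.2) hσ.1]
  · nlinarith [mul_pos (sub_pos.mpr hP.2) (sub_pos.mpr hσ.2)]

/-- `Θ` maps the open cube into itself. -/
theorem theta_mem_openCube {z : Fin 5 → ℝ} (hz : z ∈ openCube) :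
    (![z 1 + (1 - z 1) * z 0, z 1 / (z 1 + (1 - z 1) * z 0), z 2, z 3, z 4] : Fin 5 → ℝ) ∈ openCube := by
  have h0 := hz 0; have h1 := hz 1; have h2 := hz 2; have h3 := hz 3; have h4 := hz 4
  obtain ⟨hY1, hY2⟩ := Y_bounds h0 h1
  have hY0 : 0 < z 1 + (1 - z 1) * z 0 := h1.1.trans hY1
  intro i
  fin_cases i
  · exact ⟨hY0, hY2⟩
  · exact ⟨div_pos h1.1 hY0, (div_lt_one hY0).mpr hY1⟩
  · exact h2
  · exact h3
  · exact h4

/-- The inverse map `(y₁,…,y₅) ↦ ((y₁−y₁y₂)/(1−y₁y₂), y₁y₂, y₃, y₄, y₅)` maps the open cube into itself. -/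
theorem thetaInv_mem_openCube {y : Fin 5 → ℝ} (hy : y ∈ openCube) :
    (![(y 0 - y 0 * y 1) / (1 - y 0 * y 1), y 0 * y 1, y 2, y 3, y 4] : Fin 5 → ℝ) ∈ openCube := by
  have h0 := hy 0; have h1 := hy 1; have h2 := hy 2; have h3 := hy 3; have h4 := hy 4
  have hlt : y 0 * y 1 < y 0 := mul_lt_of_lt_one_right h0.1 h1.2
  have hP : 0 < y 0 * y 1 ∧ y 0 * y 1 < 1 := ⟨mul_pos h0.1 h1.1, by linarith [h0.2]⟩
  have hd : 0 < 1 - y 0 * y 1 := by linarith [hP.2]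
  have c0 : 0 < (y 0 - y 0 * y 1) / (1 - y 0 * y 1) ∧ (y 0 - y 0 * y 1) / (1 - y 0 * y 1) < 1 := by
    refine ⟨div_pos (by linarith) hd, ?_⟩
    rw [div_lt_one hd]; linarith [h0.2]
  intro i
  fin_cases i
  · exact c0
  · exact hP
  · exact h2
  · exact h3
  · exact h4

/-- `Θ ∘ Θ⁻¹ = id` on the cube. -/
theorem theta_thetaInv {y : Fin 5 → ℝ} (hy : y ∈ openCube) :
    (fun z : Fin 5 → ℝ => (![z 1 + (1 - z 1) * z 0, z 1 / (z 1 + (1 - z 1) * z 0), z 2, z 3, z 4] : Fin 5 → ℝ))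
        ![(y 0 - y 0 * y 1) / (1 - y 0 * y 1), y 0 * y 1, y 2, y 3, y 4] = y := by
  have h0 := hy 0; have h1 := hy 1
  have hd : 1 - y 0 * y 1 ≠ 0 := by nlinarith [mul_lt_of_lt_one_right h0.1 h1.2]
  have hY : y 0 * y 1 + (1 - y 0 * y 1) * ((y 0 - y 0 * y 1) / (1 - y 0 * y 1)) = y 0 := by
    field_simp; ring
  have hP : y 0 * y 1 / y 0 = y 1 := by field_simp [h0.1.ne']
  simp only [Matrix.cons_val_zero, Matrix.cons_val_one, Matrix.cons_val]
  rw [hY, hP]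
  ext i; fin_cases i <;> simp

/-- `Θ⁻¹ ∘ Θ = id` on the cube. -/
theorem thetaInv_theta {z : Fin 5 → ℝ} (hz : z ∈ openCube) :
    (fun y : Fin 5 → ℝ => (![(y 0 - y 0 * y 1) / (1 - y 0 * y 1), y 0 * y 1, y 2, y 3, y 4] : Fin 5 → ℝ))
        ![z 1 + (1 - z 1) * z 0, z 1 / (z 1 + (1 - z 1) * z 0), z 2, z 3, z 4] = z := by
  have h0 := hz 0; have h1 := hz 1
  obtain ⟨hY1, hY2⟩ := Y_bounds h0 h1
  have hY0 : (z 1 + (1 - z 1) * z 0) ≠ 0 := (h1.1.trans hY1).ne'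
  have hP : (z 1 + (1 - z 1) * z 0) * (z 1 / (z 1 + (1 - z 1) * z 0)) = z 1 := by field_simp
  have h1' : 1 - z 1 ≠ 0 := by linarith [h1.2]
  have hσ : (z 1 + (1 - z 1) * z 0 - z 1) / (1 - z 1) = z 0 := by field_simp; ring
  simp only [Matrix.cons_val_zero, Matrix.cons_val_one, Matrix.cons_val]
  rw [hP, hσ]
  ext i; fin_cases i <;> simp

/-- `Θ` is injective on the cube. -/
theorem theta_injOn :
    InjOn (fun z : Fin 5 → ℝ =>
      (![z 1 + (1 - z 1) * z 0, z 1 / (z 1 + (1 - z 1) * z 0), z 2, z 3, z 4] : Fin 5 → ℝ)) openCube := by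
  intro z hz z' hz' h
  rw [← thetaInv_theta hz, ← thetaInv_theta hz']
  exact congrArg (fun y : Fin 5 → ℝ =>
    (![(y 0 - y 0 * y 1) / (1 - y 0 * y 1), y 0 * y 1, y 2, y 3, y 4] : Fin 5 → ℝ)) h

/-- `Θ '' cube = cube`. -/
theorem theta_image :
    (fun z : Fin 5 → ℝ =>
      (![z 1 + (1 - z 1) * z 0, z 1 / (z 1 + (1 - z 1) * z 0), z 2, z 3, z 4] : Fin 5 → ℝ)) '' openCube =
      openCube := by
  apply Subset.antisymm
  · rintro _ ⟨z, hz, rfl⟩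
    exact theta_mem_openCube hz
  · intro y hy
    exact ⟨_, thetaInv_mem_openCube hy, theta_thetaInv hy⟩

/-! ### The derivative of `Θ` and its Jacobian determinant `(1 − P)/Y` -/

/-- Determinant of a `5 × 5` matrix with the block pattern `2 + 3` (identity on the last block). -/
theorem det_pattern (a b c d : ℝ) :
    Matrix.det !![a, b, 0, 0, 0; c, d, 0, 0, 0; 0, 0, 1, 0, 0; 0, 0, 0, 1, 0; 0, 0, 0, 0, 1] = a * d - b * c := by
  have s12 : (Fin.succAbove (1 : Fin 5) (2 : Fin 4)) = 3 := by decide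
  have s13 : (Fin.succAbove (1 : Fin 5) (3 : Fin 4)) = 4 := by decide
  simp [Matrix.det_succ_row_zero, Fin.sum_univ_succ, Matrix.submatrix, s12, s13]
  ring

/-- Derivative of `z ↦ Y(z) = z₁ + (1 − z₁)z₀`. -/
theorem hasFDerivAt_Y (z : Fin 5 → ℝ) :
    HasFDerivAt (fun z : Fin 5 → ℝ => z 1 + (1 - z 1) * z 0)
      ((1 - z 1) • (proj 0 : (Fin 5 → ℝ) →L[ℝ] ℝ) + (1 - z 0) • (proj 1 : (Fin 5 → ℝ) →L[ℝ] ℝ)) z := by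
  have h := (hasFDerivAt_apply (𝕜 := ℝ) 1 z).add
    (((hasFDerivAt_apply (𝕜 := ℝ) 1 z).const_sub 1).mul (hasFDerivAt_apply (𝕜 := ℝ) 0 z))
  refine HasFDerivAt.congr_fderiv h ?_
  ext v
  simp
  ring

/-- Derivative of `z ↦ z₁ / Y(z)` where `Y ≠ 0`. -/
theorem hasFDerivAt_PdivY (z : Fin 5 → ℝ) (hY : z 1 + (1 - z 1) * z 0 ≠ 0) :
    HasFDerivAt (fun z : Fin 5 → ℝ => z 1 / (z 1 + (1 - z 1) * z 0))
      ((-(z 1 * (1 - z 1)) / (z 1 + (1 - z 1) * z 0) ^ 2) • (proj 0 : (Fin 5 → ℝ) →L[ℝ] ℝ)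
        + (z 0 / (z 1 + (1 - z 1) * z 0) ^ 2) • (proj 1 : (Fin 5 → ℝ) →L[ℝ] ℝ)) z := by
  have hmul := (hasFDerivAt_apply (𝕜 := ℝ) 1 z).mul ((hasFDerivAt_inv hY).comp z (hasFDerivAt_Y z))
  refine HasFDerivAt.congr_fderiv (hmul.congr_of_eventuallyEq ?_) ?_
  · exact Filter.Eventually.of_forall fun w => by simp [div_eq_mul_inv]
  · ext v
    simp
    field_simp
    ring

/-- **`Θ` is differentiable where `Y ≠ 0`, with Jacobian determinant `(1 − z₁)/Y(z)`.** -/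
theorem hasFDerivAt_theta (z : Fin 5 → ℝ) (hY : z 1 + (1 - z 1) * z 0 ≠ 0) :
    ∃ f' : (Fin 5 → ℝ) →L[ℝ] (Fin 5 → ℝ),
      HasFDerivAt (fun z : Fin 5 → ℝ =>
        (![z 1 + (1 - z 1) * z 0, z 1 / (z 1 + (1 - z 1) * z 0), z 2, z 3, z 4] : Fin 5 → ℝ)) f' z ∧
      f'.det = (1 - z 1) / (z 1 + (1 - z 1) * z 0) := by
  refine ⟨ContinuousLinearMap.pi
    ![(1 - z 1) • (proj 0 : (Fin 5 → ℝ) →L[ℝ] ℝ) + (1 - z 0) • (proj 1 : (Fin 5 → ℝ) →L[ℝ] ℝ),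
      (-(z 1 * (1 - z 1)) / (z 1 + (1 - z 1) * z 0) ^ 2) • (proj 0 : (Fin 5 → ℝ) →L[ℝ] ℝ)
        + (z 0 / (z 1 + (1 - z 1) * z 0) ^ 2) • (proj 1 : (Fin 5 → ℝ) →L[ℝ] ℝ),
      (proj 2 : (Fin 5 → ℝ) →L[ℝ] ℝ), (proj 3 : (Fin 5 → ℝ) →L[ℝ] ℝ), (proj 4 : (Fin 5 → ℝ) →L[ℝ] ℝ)], ?_, ?_⟩
  · refine hasFDerivAt_pi'' fun k => ?_
    rw [ContinuousLinearMap.proj_pi]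
    fin_cases k
    · simpa using hasFDerivAt_Y z
    · simpa using hasFDerivAt_PdivY z hY
    · simpa using hasFDerivAt_apply (𝕜 := ℝ) (2 : Fin 5) z
    · simpa using hasFDerivAt_apply (𝕜 := ℝ) (3 : Fin 5) z
    · simpa using hasFDerivAt_apply (𝕜 := ℝ) (4 : Fin 5) z
  · have hM : LinearMap.toMatrix' ((ContinuousLinearMap.pi
        ![(1 - z 1) • (proj 0 : (Fin 5 → ℝ) →L[ℝ] ℝ) + (1 - z 0) • (proj 1 : (Fin 5 → ℝ) →L[ℝ] ℝ),
          (-(z 1 * (1 - z 1)) / (z 1 + (1 - z 1) * z 0) ^ 2) • (proj 0 : (Fin 5 → ℝ) →L[ℝ] ℝ)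
            + (z 0 / (z 1 + (1 - z 1) * z 0) ^ 2) • (proj 1 : (Fin 5 → ℝ) →L[ℝ] ℝ),
          (proj 2 : (Fin 5 → ℝ) →L[ℝ] ℝ), (proj 3 : (Fin 5 → ℝ) →L[ℝ] ℝ),
          (proj 4 : (Fin 5 → ℝ) →L[ℝ] ℝ)] : (Fin 5 → ℝ) →L[ℝ] (Fin 5 → ℝ)) : (Fin 5 → ℝ) →ₗ[ℝ] (Fin 5 → ℝ))
        = !![1 - z 1, 1 - z 0, 0, 0, 0;
             -(z 1 * (1 - z 1)) / (z 1 + (1 - z 1) * z 0) ^ 2, z 0 / (z 1 + (1 - z 1) * z 0) ^ 2, 0, 0, 0;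
             0, 0, 1, 0, 0;
             0, 0, 0, 1, 0;
             0, 0, 0, 0, 1] := by
      ext i j
      rw [LinearMap.toMatrix'_apply]
      fin_cases i <;> fin_cases j <;> simp
    rw [ContinuousLinearMap.det, ← LinearMap.det_toMatrix', hM, det_pattern]
    field_simp
    ring

/-! ### The transformed integrand: `|det| · integrandJ ∘ Θ` in coordinates -/

/-- The integrand (10) split into its `(y₁,y₂)`-block and the rest. -/
theorem integrandJ_split (p : Fin 7 → ℤ) (q : Fin 5 → ℤ) (y0 y1 u v w : ℝ) :
    integrandJ p q ![y0, y1, u, v, w] =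
      (u ^ (p 3 + 1) * (1 - u) ^ (q 2) * v ^ (p 4) * (1 - v) ^ (q 3) * w ^ (p 5) * (1 - w) ^ (q 4) /
          (1 - u * (1 - v * w)) ^ (p 6 + 1)) *
        (y0 ^ (p 1) * (1 - y0) ^ (q 0) * y1 ^ (p 2) * (1 - y1) ^ (q 1) / (1 - u * (1 - y0 * y1)) ^ (p 0 + 1)) := by
  simp only [integrandJ, Matrix.cons_val_zero, Matrix.cons_val_one, Matrix.cons_val]
  rw [div_mul_div_comm]
  congr 1 <;> ring

/-- The `(y₁,y₂)`-block after the substitution `y₁ = Y = P+(1−P)s`, `y₂ = P/Y`, multiplied by the Jacobian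
`(1−P)/Y`: a Laurent-monomial identity in the positive atoms `P, 1−P, s, 1−s, Y`. -/
theorem block_theta {s P u : ℝ} (hs : 0 < s ∧ s < 1) (hP : 0 < P ∧ P < 1) (a e : ℤ) (n₁ n₂ m : ℕ) :
    (1 - P) / (P + (1 - P) * s) *
        ((P + (1 - P) * s) ^ (a + n₂ - m) * (1 - (P + (1 - P) * s)) ^ n₁ * (P / (P + (1 - P) * s)) ^ a *
          (1 - P / (P + (1 - P) * s)) ^ n₂ / (1 - u * (1 - (P + (1 - P) * s) * (P / (P + (1 - P) * s)))) ^ e) =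
      P ^ a * (1 - P) ^ (n₁ + n₂ + 1) / (1 - u * (1 - P)) ^ e *
        (s ^ n₂ * (1 - s) ^ n₁ / (P + (1 - P) * s) ^ (m + 1)) := by
  obtain ⟨hY1, hY2⟩ := Y_bounds hs hP
  have hY0 : P + (1 - P) * s ≠ 0 := (hP.1.trans hY1).ne'
  rw [mul_div_cancel₀ _ hY0,
    show (1:ℝ) - (P + (1 - P) * s) = (1 - P) * (1 - s) by ring,
    show (1:ℝ) - P / (P + (1 - P) * s) = (1 - P) * s / (P + (1 - P) * s) by field_simp; ring,
    zpow_sub₀ hY0, zpow_add₀ hY0, zpow_natCast, zpow_natCast, div_zpow, div_pow, mul_pow, mul_pow]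
  have hYa : (P + (1 - P) * s) ^ a ≠ 0 := zpow_ne_zero _ hY0
  generalize (P + (1 - P) * s) = Y at hY0 hYa ⊢
  generalize (P ^ a) = Pa
  generalize (Y ^ a) = Ya at hYa ⊢
  generalize ((1 - u * (1 - P)) ^ e) = D
  field_simp
  ring

/-- **Pointwise identity**: for `0 < s, P < 1`, with `Y = P + (1−P)s`, `q₁ = n₁`, `q₂ = n₂` and
`p₂ + q₂ − p₁ = m`,
`(1−P)/Y · integrandJ p q (Y, P/Y, u, v, w) = P^{p₂}(1−P)^{n₁+n₂+1}·R(P,u,v,w) · s^{n₂}(1−s)^{n₁}/Y^{m+1}`. -/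
theorem theta_integrand_coord (p : Fin 7 → ℤ) (q : Fin 5 → ℤ) {n₁ n₂ m : ℕ} (hq0 : q 0 = n₁) (hq1 : q 1 = n₂)
    (hm : p 2 + q 1 - p 1 = m) (s P u v w : ℝ) (hs : 0 < s ∧ s < 1) (hP : 0 < P ∧ P < 1) :
    (1 - P) / (P + (1 - P) * s) *
        integrandJ p q ![P + (1 - P) * s, P / (P + (1 - P) * s), u, v, w] =
      (u ^ (p 3 + 1) * (1 - u) ^ (q 2) * v ^ (p 4) * (1 - v) ^ (q 3) * w ^ (p 5) * (1 - w) ^ (q 4) /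
          (1 - u * (1 - v * w)) ^ (p 6 + 1)) *
        (P ^ (p 2) * (1 - P) ^ (n₁ + n₂ + 1) / (1 - u * (1 - P)) ^ (p 0 + 1)) *
        (s ^ n₂ * (1 - s) ^ n₁ / (P + (1 - P) * s) ^ (m + 1)) := by
  have hp1 : p 1 = p 2 + (n₂ : ℤ) - (m : ℤ) := by omega
  rw [integrandJ_split, hq0, hq1, hp1, mul_left_comm ((1 - P) / (P + (1 - P) * s))]
  simp only [zpow_natCast]
  rw [block_theta hs hP (p 2) (p 0 + 1) n₁ n₂ m]
  exact (mul_assoc _ _ _).symm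


/-- `Θ` is measurable. -/
theorem measurable_theta :
    Measurable (fun z : Fin 5 → ℝ =>
      (![z 1 + (1 - z 1) * z 0, z 1 / (z 1 + (1 - z 1) * z 0), z 2, z 3, z 4] : Fin 5 → ℝ)) := by
  refine measurable_pi_lambda _ fun i => ?_
  fin_cases i <;> simp <;> fun_prop

/-- **`J(p;q)` after the fibration change of variables** (Bochner change of variables on the cube; no
integrability hypothesis): `J(p;q) = ∫_{(0,1)⁵} (1−z₂)/Y · integrandJ p q (Θ z) dz`. -/
theorem Jintegral_theta (p : Fin 7 → ℤ) (q : Fin 5 → ℤ) :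
    Jintegral p q = ∫ z in openCube, (1 - z 1) / (z 1 + (1 - z 1) * z 0) *
      integrandJ p q ![z 1 + (1 - z 1) * z 0, z 1 / (z 1 + (1 - z 1) * z 0), z 2, z 3, z 4] := by
  have hex : ∀ z : Fin 5 → ℝ, ∃ f' : (Fin 5 → ℝ) →L[ℝ] (Fin 5 → ℝ), z ∈ openCube →
      HasFDerivAt (fun z : Fin 5 → ℝ =>
        (![z 1 + (1 - z 1) * z 0, z 1 / (z 1 + (1 - z 1) * z 0), z 2, z 3, z 4] : Fin 5 → ℝ)) f' z ∧
      f'.det = (1 - z 1) / (z 1 + (1 - z 1) * z 0) := by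
    intro z
    by_cases hz : z ∈ openCube
    · obtain ⟨f', hf'⟩ := hasFDerivAt_theta z ((hz 1).1.trans (Y_bounds (hz 0) (hz 1)).1).ne'
      exact ⟨f', fun _ => hf'⟩
    · exact ⟨0, fun h => (hz h).elim⟩
  choose f' hf' using hex
  have hderiv : ∀ z ∈ openCube, HasFDerivWithinAt (fun z : Fin 5 → ℝ =>
      (![z 1 + (1 - z 1) * z 0, z 1 / (z 1 + (1 - z 1) * z 0), z 2, z 3, z 4] : Fin 5 → ℝ)) (f' z) openCube z :=
    fun z hz => (hf' z hz).1.hasFDerivWithinAt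
  have hcv := integral_image_eq_integral_abs_det_fderiv_smul volume measurableSet_openCube hderiv theta_injOn
    (integrandJ p q)
  rw [theta_image] at hcv
  unfold Jintegral
  rw [hcv]
  refine setIntegral_congr_fun measurableSet_openCube fun z hz => ?_
  have h0 := hz 0; have h1 := hz 1
  obtain ⟨hY1, -⟩ := Y_bounds h0 h1
  rw [(hf' z hz).2, abs_of_pos (div_pos (by linarith [h1.2]) (h1.1.trans hY1)), smul_eq_mul]

end Summit.KontsevichZagierPeriods.Zeta5Search.JintegralEulerTheta

end
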